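import Mathlib.AlgebraicGeometry.EllipticCurve.DivisionPolynomial.Degree
import Mathlib.FieldTheory.IsAlgClosed.Basic
import Mathlib.Algebra.Polynomial.FieldDivision
import Literature.NumberTheory.EllipticCurves.GaloisAction
import Literature.NumberTheory.EllipticCurves.TwoTorsion
import Literature.NumberTheory.EllipticCurves.DivisionPolynomialMultiplication
import HarnessLib

/-!
# `#E[n] = n²` for elliptic curves over algebraically closed fields (Silverman, AEC, III.6.4(b))

Topic `NumberTheory/EllipticCurves`; companion to `GaloisAction.lean`, whose named fact
`WeierstrassCurve.card_torsionPoints_eq_sq` (Silverman, *AEC*, Cor. III.6.4(b): for `E/F` elliptic,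
`L ⊇ F` algebraically closed and `n ≠ 0` in `L`, `#E(L)[n] = n²`) is discharged in
`GaloisActionProofs.lean` through the main theorem of this file,
`WeierstrassCurve.card_torsionBy_eq_sq`: for an elliptic curve `E` over an algebraically closed
field `L` and `n : ℕ` with `n ≠ 0` in `L`, `Nat.card E(L)[n] = n²`.

Silverman proves III.6.4(b) from `deg [m] = m²` (III.6.2(d), dual isogenies) and the separability
of `[m]` (III.4.10(c), III.5.4); none of this is in Mathlib. We follow instead his elementary route,
Exercise 3.7: the multiplication-by-`n` formula `x([n]P) = φₙ(P)/ψₙ(P)²` and "`ψₙ(P) = 0 ↔ [n]P = O`"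
(Exercise 3.7(d),(f)), proved in the tree file `DivisionPolynomialMultiplication.lean`
(`WeierstrassCurve.Affine.Point.zsmul_some_eq_zero_iff`, `zsmul_some_eq_some_φ_div`), give the
fibres of `x ∘ [n] = Φₙ/ΨSqₙ` explicitly, and counting a generic fibre gives `#E[n] = n²`
(this is the fibre count behind III.4.10(c), made elementary).

## Contents (all proved)

* Fibres of `x`: `sub_negY_sq_eq_eval_Ψ₂Sq` (`(2y + a₁x + a₃)² = Ψ₂Sq(x)` on the curve),
  `ne_negY_of_eval_Ψ₂Sq_ne_zero`, `equation_iff_eq_or_eq_negY`.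
* The formula in univariate form (Mathlib's `Φₙ`, `ΨSqₙ`, with `φₙ ≡ Φₙ`, `ψₙ² ≡ ΨSqₙ` modulo the
  equation): `evalEval_φ_eq_eval_Φ`, `zsmul_some_eq_zero_iff_eval_ΨSq` (`[n]P = O ↔ ΨSqₙ(x) = 0`),
  `mul_eval_ΨSq_of_zsmul_eq` (`[n]P = (x', y') → x' ΨSqₙ(x) = Φₙ(x)`).
* `eval_Φ_ne_zero_of_eval_ΨSq_eq_zero` (Exercise 3.7(c): `Φₙ`, `ΨSqₙ` have no common root at the
  abscissa of a point), `wronskian_Φ_ΨSq_ne_zero` (`Φₙ' ΨSqₙ − Φₙ ΨSqₙ' ≠ 0` for `n ≠ 0` in `K`,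
  i.e. `x ∘ [n]` is separable; leading terms `Φₙ = X^{n²} + …`, `ΨSqₙ = n² X^{n²-1} + …`,
  Exercise 3.7(b), Mathlib's `natDegree_Φ`, `coeff_Φ`, `natDegree_ΨSq`, `coeff_ΨSq`).
* `encard_setOf_X_mem`: the affine points with abscissa in a finite set `R` avoiding the roots of
  `Ψ₂Sq` number `2 · #R`; `card_torsionBy_eq_sq`: the count.

## The argument (`card_torsionBy_eq_sq`)

Let `p = Φₙ` (monic, degree `n²`) and `q = ΨSqₙ` (degree `n² − 1`, leading coefficient `n²`).
For `a ∈ L` avoiding finitely many values, `f = p − a·q` has `n²` simple roots (a double root `x`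
would be a root of the Wronskian with `a = p(x)/q(x)`), none of which is a root of `q` (no common
roots) or of `Ψ₂Sq`, and `Ψ₂Sq(a) ≠ 0`. The set `S` of affine points whose abscissa is a root of
`f` has `2n²` elements (two ordinates over each root). By the two halves of the formula, `S` is
exactly the set of `P` with `[n]P = ±Q₀`, `Q₀ = (a, b)`, and `Q₀ ≠ −Q₀`; the two fibres are
interchanged by negation and each is a coset of `E[n]`. Hence `2·#E[n] = 2n²`.

## References

* J. H. Silverman, *The Arithmetic of Elliptic Curves*, 2nd ed., GTM 106, Springer 2009:
  Cor. III.6.4 (pp. 81–82 of the held text), Exercise 3.7 (pp. 97–98). [SilvermanAEC2009]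

## Design

* As in `GaloisAction.lean`: `noncomputable section`, `open scoped Classical` (the group law on
  `Affine.Point` uses the classical `DecidableEq`), universe-monomorphic `L : Type u` in the count.
* Deliberate dot-notation extensions of Mathlib's `WeierstrassCurve`. No new definitions: the
  ordinate over `x` is chosen with `choose` inside the proofs; cardinalities are computed in `ℕ∞`
  (`Set.encard`).
-/

noncomputable section

open scoped Classical
open Polynomial

namespace WeierstrassCurve

universe u v

variable {K : Type v} [Field K] (W : WeierstrassCurve K)

/-! ## Affine points with a given `x`-coordinate -/

/-- On the curve, `(2y + a₁x + a₃)² = Ψ₂Sq(x)`: the square of `y - negY x y` is the value of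
the univariate `2`-division polynomial. Silverman, *AEC*, Exercise 3.7(a). [folklore] -/
theorem sub_negY_sq_eq_eval_Ψ₂Sq {x y : K} (h : W.toAffine.Equation x y) :
    (y - W.toAffine.negY x y) ^ 2 = (W.Ψ₂Sq).eval x := by
  have h' := (Affine.equation_iff x y).mp h
  simp only [Affine.negY, Ψ₂Sq, b₂, b₄, b₆, eval_add, eval_mul, eval_C, eval_pow, eval_X]
  linear_combination 4 * h'

/-- If `Ψ₂Sq(x) ≠ 0` then an affine point `(x, y)` on the curve is not its own negative:
`y ≠ negY x y`. [folklore] -/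
theorem ne_negY_of_eval_Ψ₂Sq_ne_zero {x y : K} (h : W.toAffine.Equation x y)
    (hx : (W.Ψ₂Sq).eval x ≠ 0) : y ≠ W.toAffine.negY x y := fun hy =>
  hx <| by
    have := W.sub_negY_sq_eq_eval_Ψ₂Sq h
    rw [← hy, sub_self, zero_pow two_ne_zero] at this
    exact this.symm

/-- The affine points with `x`-coordinate `x` are `(x, y₀)` and `(x, negY x y₀)` for any one
solution `y₀`. [folklore] -/
theorem equation_iff_eq_or_eq_negY {x y₀ : K} (h₀ : W.toAffine.Equation x y₀) (y : K) :
    W.toAffine.Equation x y ↔ y = y₀ ∨ y = W.toAffine.negY x y₀ := by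
  refine ⟨fun h => Affine.Y_eq_of_X_eq h h₀ rfl, ?_⟩
  rintro (rfl | rfl)
  · exact h₀
  · exact (Affine.equation_neg x y₀).mpr h₀

/-! ## The multiplication-by-`n` formula in univariate form -/

/-- On the curve, `φₙ(x, y) = Φₙ(x)` (Mathlib: `φₙ ≡ Φₙ` in the coordinate ring,
`Affine.CoordinateRing.mk_φ`). Silverman, *AEC*, Exercise 3.7(a). [folklore] -/
theorem evalEval_φ_eq_eval_Φ {x y : K} (h : W.toAffine.Equation x y) (n : ℤ) :
    (W.φ n).evalEval x y = (W.Φ n).eval x := by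
  have e := congrArg (AdjoinRoot.evalEval h) (Affine.CoordinateRing.mk_φ W n)
  simpa only [AdjoinRoot.evalEval_mk, evalEval_C] using e

/-- **`[n]P = O ↔ ΨSqₙ(x(P)) = 0`** (Silverman, *AEC*, Exercise 3.7(f): `ψₙ` vanishes exactly at the
nontrivial `n`-torsion points; tree theorem `Affine.Point.zsmul_some_eq_zero_iff`, and
`ψₙ(P)² = ΨSqₙ(x)` on the curve). [cite: SilvermanAEC2009, Exercise 3.7(f)] -/
theorem zsmul_some_eq_zero_iff_eval_ΨSq {x y : K} (h : W.toAffine.Nonsingular x y) (n : ℤ) :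
    n • (Affine.Point.some x y h : W.toAffine.Point) = 0 ↔ (W.ΨSq n).eval x = 0 := by
  rw [Affine.Point.zsmul_some_eq_zero_iff h n, ← W.evalEval_ψ_sq h.left n]
  exact ⟨fun h0 => by rw [h0, zero_pow two_ne_zero], fun h0 => (pow_eq_zero_iff two_ne_zero).mp h0⟩

/-- **`x([n]P) · ΨSqₙ(x) = Φₙ(x)`** (Silverman, *AEC*, Exercise 3.7(d): `x([n]P) = φₙ(P)/ψₙ(P)²`;
tree theorem `Affine.Point.zsmul_some_eq_some_φ_div`, made denominator-free and univariate).
[cite: SilvermanAEC2009, Exercise 3.7(d)] -/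
theorem mul_eval_ΨSq_of_zsmul_eq {x y : K} (h : W.toAffine.Nonsingular x y) (n : ℤ) {x' y' : K}
    (h' : W.toAffine.Nonsingular x' y')
    (hn : n • (Affine.Point.some x y h : W.toAffine.Point) = Affine.Point.some x' y' h') :
    x' * (W.ΨSq n).eval x = (W.Φ n).eval x := by
  have hψ : (W.ψ n).evalEval x y ≠ 0 := fun h0 => by
    have e := (Affine.Point.zsmul_some_eq_zero_iff h n).mpr h0
    rw [hn] at e
    exact Affine.Point.some_ne_zero _ e
  obtain ⟨y₁, hns, e⟩ := Affine.Point.zsmul_some_eq_some_φ_div h hψ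
  rw [hn] at e
  have hx : x' = (W.φ n).evalEval x y / (W.ψ n).evalEval x y ^ 2 :=
    ((Affine.Point.some.injEq _ _ _ _ _ _).mp e).1
  rw [hx, ← W.evalEval_ψ_sq h.left n, ← W.evalEval_φ_eq_eval_Φ h.left n,
    div_mul_cancel₀ _ (pow_ne_zero 2 hψ)]

/-! ## `Φₙ` and `ΨSqₙ` have no common root; the Wronskian is nonzero -/

/-- `Φₙ` and `ΨSqₙ = ψₙ²` have no common root at the `x`-coordinate of a nonsingular point
(Silverman, *AEC*, Exercise 3.7(c)), derived from `zsmul_some_eq_zero_iff_eval_ΨSq` and the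
definition `Φₙ = X·ΨSqₙ − preΨₙ₊₁·preΨₙ₋₁·(1|Ψ₂Sq)`: a common root would give a nonzero point
killed by `n` and by `n ± 1` (or, for `n` odd, by `2`). [cite: SilvermanAEC2009, Exercise 3.7(c)] -/
theorem eval_Φ_ne_zero_of_eval_ΨSq_eq_zero {x y : K} (h : W.toAffine.Nonsingular x y) {n : ℤ}
    (hΨ : (W.ΨSq n).eval x = 0) : (W.Φ n).eval x ≠ 0 := by
  intro hΦ
  set P := Affine.Point.some x y h
  have hP0 : P ≠ 0 := Affine.Point.some_ne_zero h
  have hn : n • P = 0 := (W.zsmul_some_eq_zero_iff_eval_ΨSq h n).mpr hΨ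
  have key : ∀ m : ℤ, (W.preΨ m).eval x = 0 → m • P = 0 := fun m hm =>
    (W.zsmul_some_eq_zero_iff_eval_ΨSq h m).mpr (by rw [ΨSq]; split_ifs <;> simp [hm])
  have hΦ' : (W.preΨ (n + 1)).eval x * (W.preΨ (n - 1)).eval x *
      (if Even n then 1 else W.Ψ₂Sq).eval x = 0 := by
    have := hΦ
    simp only [WeierstrassCurve.Φ, eval_sub, eval_mul, eval_X, hΨ, mul_zero, zero_sub,
      neg_eq_zero] at this
    exact this
  rcases mul_eq_zero.mp hΦ' with h12 | h3
  · rcases mul_eq_zero.mp h12 with h1 | h2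
    · apply hP0
      have := key _ h1
      rwa [add_zsmul, one_zsmul, hn, zero_add] at this
    · apply hP0
      have := key _ h2
      rw [sub_zsmul, one_zsmul, hn] at this
      simp at this
  · split_ifs at h3 with he
    · simp at h3
    · have h2 : (2 : ℤ) • P = 0 := (W.zsmul_some_eq_zero_iff_eval_ΨSq h 2).mpr (by simpa using h3)
      obtain ⟨k, rfl⟩ := Int.not_even_iff_odd.mp he
      apply hP0
      have := hn
      rwa [add_zsmul, one_zsmul, mul_comm, mul_zsmul, h2, zsmul_zero, zero_add] at this

/-- For `2 ≤ n` with `n ≠ 0` in `K`, the Wronskian `Φₙ' ΨSqₙ − Φₙ ΨSqₙ'` is a nonzero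
polynomial: its coefficient in degree `2n² − 2` is `n² · n² − 1 · n²(n² − 1) = n²` (leading
terms `Φₙ = X^{n²} + …`, `ΨSqₙ = n² X^{n²−1} + …`, Silverman, *AEC*, Exercise 3.7(b), in
Mathlib as `natDegree_Φ`, `coeff_Φ`, `natDegree_ΨSq`, `coeff_ΨSq`). Equivalently the rational
function `x ∘ [n] = Φₙ/ΨSqₙ` has nonzero derivative, i.e. `[n]` is separable
(cf. *AEC*, Cor. III.5.4). [cite: SilvermanAEC2009, Exercise 3.7(b)] -/
theorem wronskian_Φ_ΨSq_ne_zero {n : ℕ} (hn2 : 2 ≤ n) (hn : (n : K) ≠ 0) :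
    derivative (W.Φ n) * W.ΨSq n - W.Φ n * derivative (W.ΨSq n) ≠ 0 := by
  have hn4 : 4 ≤ n ^ 2 := by nlinarith
  obtain ⟨m, hm⟩ : ∃ m : ℕ, n ^ 2 = m + 2 := ⟨n ^ 2 - 2, by omega⟩
  have hnat : ((n : ℤ)).natAbs = n := Int.natAbs_natCast n
  have hnat2 : ((n : ℤ)).natAbs ^ 2 = m + 2 := by rw [hnat, hm]
  have hnK : ((n : ℤ) : K) ≠ 0 := by exact_mod_cast hn
  have hmK : (m : K) + 2 = (n : K) ^ 2 := by
    exact_mod_cast (congrArg (fun k : ℕ => (k : K)) hm).symm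
  have dp : (W.Φ n).natDegree = m + 2 := by rw [natDegree_Φ, hnat2]
  have cp : (W.Φ n).coeff (m + 2) = 1 := by rw [← hnat2, coeff_Φ]
  have dq : (W.ΨSq n).natDegree = m + 1 := by rw [natDegree_ΨSq _ hnK, hnat2]; omega
  have cq : (W.ΨSq n).coeff (m + 1) = (n : K) ^ 2 := by
    rw [show m + 1 = ((n : ℤ)).natAbs ^ 2 - 1 by rw [hnat2]; omega, coeff_ΨSq]
    push_cast
    ring
  have dp' : (derivative (W.Φ n)).natDegree ≤ m + 1 :=
    (natDegree_derivative_le _).trans (by rw [dp]; omega)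
  have cp' : (derivative (W.Φ n)).coeff (m + 1) = (n : K) ^ 2 := by
    rw [coeff_derivative, show m + 1 + 1 = m + 2 from rfl, cp, one_mul]
    push_cast
    linear_combination hmK
  have dq' : (derivative (W.ΨSq n)).natDegree ≤ m :=
    (natDegree_derivative_le _).trans (by rw [dq]; omega)
  have cq' : (derivative (W.ΨSq n)).coeff m = (n : K) ^ 2 * ((n : K) ^ 2 - 1) := by
    rw [coeff_derivative, cq]
    linear_combination (n : K) ^ 2 * hmK
  intro h0
  have := congrArg (coeff · ((m + 1) + (m + 1))) h0
  simp only [coeff_sub, coeff_zero] at this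
  rw [coeff_mul_add_eq_of_natDegree_le dp' dq.le, show (m + 1) + (m + 1) = (m + 2) + m by ring,
    coeff_mul_add_eq_of_natDegree_le dp.le dq', cp', cq, cp, cq'] at this
  apply pow_ne_zero 2 hn
  linear_combination this

/-! ## The count -/

section Count

variable {L : Type u} [Field L] [IsAlgClosed L] (E : WeierstrassCurve L) [E.IsElliptic]

/-- The affine points `(x, y) ∈ E(L)` (`L` algebraically closed, `E` elliptic) with `x` in a
finite set `R` avoiding the roots of `Ψ₂Sq` number `2 · #R`: two ordinates over each abscissa.
[folklore] -/
theorem encard_setOf_X_mem (R : Finset L) (hR : ∀ x ∈ R, (E.Ψ₂Sq).eval x ≠ 0) :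
    {P : E.toAffine.Point | ∃ x y, ∃ h : E.toAffine.Nonsingular x y,
      P = Affine.Point.some x y h ∧ x ∈ R}.encard = 2 * R.card := by
  choose y₀ hy₀ using E.exists_equation
  have hns : ∀ x, E.toAffine.Nonsingular x (y₀ x) := fun x =>
    Affine.equation_iff_nonsingular.mp (hy₀ x)
  have hns' : ∀ x, E.toAffine.Nonsingular x (E.toAffine.negY x (y₀ x)) := fun x =>
    (Affine.nonsingular_neg x _).mpr (hns x)
  -- the two points over `x`
  set pts : L → Finset E.toAffine.Point := fun x =>
    {Affine.Point.some x (y₀ x) (hns x), Affine.Point.some x _ (hns' x)} with hpts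
  have hmem : ∀ x (P : E.toAffine.Point), P ∈ pts x ↔
      ∃ y, ∃ h : E.toAffine.Nonsingular x y, P = Affine.Point.some x y h := by
    intro x P
    simp only [hpts, Finset.mem_insert, Finset.mem_singleton]
    constructor
    · rintro (rfl | rfl)
      · exact ⟨_, _, rfl⟩
      · exact ⟨_, _, rfl⟩
    · rintro ⟨y, h, rfl⟩
      rcases (E.equation_iff_eq_or_eq_negY (hy₀ x) y).mp h.left with hy | hy
      · left
        simp only [hy]
      · right
        simp only [hy]
  have hcard : ∀ x ∈ R, (pts x).card = 2 := fun x hx => by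
    simp only [hpts]
    rw [Finset.card_pair]
    intro h
    exact E.ne_negY_of_eval_Ψ₂Sq_ne_zero (hy₀ x) (hR x hx)
      ((Affine.Point.some.injEq _ _ _ _ _ _).mp h).2
  set T : Finset E.toAffine.Point := R.biUnion pts with hT
  have hST : {P : E.toAffine.Point | ∃ x y, ∃ h : E.toAffine.Nonsingular x y,
      P = Affine.Point.some x y h ∧ x ∈ R} = ↑T := by
    ext P
    simp only [Set.mem_setOf_eq, hT, Finset.coe_biUnion, Finset.mem_coe, Set.mem_iUnion,
      exists_prop]
    constructor
    · rintro ⟨x, y, h, rfl, hx⟩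
      exact ⟨x, hx, (hmem x _).mpr ⟨y, h, rfl⟩⟩
    · rintro ⟨x, hx, hP⟩
      obtain ⟨y, h, rfl⟩ := (hmem x P).mp hP
      exact ⟨x, y, h, rfl, hx⟩
  have hTcard : T.card = 2 * R.card := by
    rw [hT, Finset.card_biUnion]
    · rw [Finset.sum_congr rfl hcard, Finset.sum_const, smul_eq_mul, mul_comm]
    · intro x _ x' _ hxx'
      simp only [Function.onFun, Finset.disjoint_left]
      intro P hP hP'
      obtain ⟨y, h, rfl⟩ := (hmem x P).mp hP
      obtain ⟨y', h', e⟩ := (hmem x' _).mp hP'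
      exact hxx' ((Affine.Point.some.injEq _ _ _ _ _ _).mp e).1
  rw [hST, Set.encard_coe_eq_coe_finsetCard, hTcard]
  push_cast
  rfl

variable {E}

/-- **`#E[n] = n²`** (Silverman, *AEC*, Cor. III.6.4(b)): for an elliptic curve `E` over an
algebraically closed field `L` and `n : ℕ` with `n ≠ 0` in `L`, the `n`-torsion subgroup of `E(L)`
has exactly `n²` elements. Proof (Silverman's elementary route, Exercise 3.7): for `a ∈ L`
outside a finite set the fibre of `x ∘ [n] = Φₙ/ΨSqₙ` over `a` consists of `2n²` affine points
(the polynomial `Φₙ − a·ΨSqₙ` of degree `n²` is separable because the Wronskian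
`wronskian_Φ_ΨSq_ne_zero` does not vanish identically, and each of its roots carries two
ordinates), and it is the disjoint union of the two cosets `[n]⁻¹(a, b)` and `[n]⁻¹(-(a, b))` of
`E[n]`. [cite: SilvermanAEC2009, Cor. III.6.4(b) and Exercise 3.7] -/
theorem card_torsionBy_eq_sq {n : ℕ} (hn : (n : L) ≠ 0) :
    Nat.card (AddSubgroup.torsionBy E.toAffine.Point (n : ℤ)) = n ^ 2 := by
  -- an ordinate over each abscissa
  choose y₀ hy₀ using E.exists_equation
  have hns : ∀ x, E.toAffine.Nonsingular x (y₀ x) := fun x =>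
    Affine.equation_iff_nonsingular.mp (hy₀ x)
  -- `n = 1`
  rcases Nat.lt_or_ge n 2 with hn2 | hn2
  · interval_cases n
    · exact absurd Nat.cast_zero hn
    · have : AddSubgroup.torsionBy E.toAffine.Point ((1 : ℕ) : ℤ) = ⊥ := by
        ext P
        rw [AddSubgroup.mem_bot]
        exact (Submodule.mem_torsionBy_iff (R := ℤ) _ P).trans (by rw [Nat.cast_one, one_zsmul])
      rw [this, AddSubgroup.card_bot]
      rfl
  -- notation
  set p : L[X] := E.Φ n with hp
  set q : L[X] := E.ΨSq n with hq
  have hnat2 : ((n : ℤ)).natAbs ^ 2 = n ^ 2 := by rw [Int.natAbs_natCast]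
  have hnL : ((n : ℤ) : L) ≠ 0 := by exact_mod_cast hn
  have dp : p.natDegree = n ^ 2 := by rw [hp, natDegree_Φ, hnat2]
  have mp : p.Monic := by
    rw [Monic, leadingCoeff, dp, hp, ← hnat2, coeff_Φ]
  have dq : q.natDegree = n ^ 2 - 1 := by rw [hq, natDegree_ΨSq _ hnL, hnat2]
  have dq' : q.natDegree < n ^ 2 := by
    rw [dq]; have : 1 ≤ n ^ 2 := Nat.one_le_pow _ _ (by omega); omega
  -- no common roots
  have hcop : ∀ x : L, q.eval x = 0 → p.eval x ≠ 0 := fun x hx =>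
    E.eval_Φ_ne_zero_of_eval_ΨSq_eq_zero (hns x) hx
  -- the Wronskian
  set D : L[X] := derivative p * q - p * derivative q with hD
  have hD0 : D ≠ 0 := E.wronskian_Φ_ΨSq_ne_zero hn2 hn
  -- a generic value `a`
  set r : L → L := fun x => p.eval x / q.eval x with hr
  set Bad : Set L :=
    r '' {x | D.IsRoot x} ∪ r '' {x | E.Ψ₂Sq.IsRoot x} ∪ {a | E.Ψ₂Sq.IsRoot a} with hBad
  have hBadfin : Bad.Finite :=
    (((finite_setOf_isRoot hD0).image r).union
      ((finite_setOf_isRoot E.Ψ₂Sq_ne_zero_of_isElliptic).image r)).union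
      (finite_setOf_isRoot E.Ψ₂Sq_ne_zero_of_isElliptic)
  obtain ⟨a, ha⟩ := hBadfin.infinite_compl.nonempty
  simp only [hBad, Set.mem_compl_iff, Set.mem_union, Set.mem_image, Set.mem_setOf_eq,
    not_or, not_exists, not_and] at ha
  obtain ⟨⟨haD, haΨ⟩, ha2⟩ := ha
  -- the polynomial `f = Φₙ - a ΨSqₙ`
  set f : L[X] := p - C a * q with hf
  have hlt : (C a * q).natDegree < p.natDegree :=
    (natDegree_C_mul_le a q).trans_lt (by rw [dp]; exact dq')
  have mf : f.Monic := mp.sub_of_left (degree_lt_degree hlt)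
  have df : f.natDegree = n ^ 2 := by rw [hf, natDegree_sub_eq_left_of_natDegree_lt hlt, dp]
  have hf0 : f ≠ 0 := mf.ne_zero
  have hfeval : ∀ x, f.eval x = p.eval x - a * q.eval x := fun x => by
    simp only [hf, eval_sub, eval_mul, eval_C]
  -- at roots of `f`: `q ≠ 0`, `r = a`, `Ψ₂Sq ≠ 0`
  have hfq : ∀ x, f.IsRoot x → q.eval x ≠ 0 := fun x hx hqx =>
    hcop x hqx (by rwa [IsRoot.def, hfeval, hqx, mul_zero, sub_zero] at hx)
  have hfp : ∀ x, f.IsRoot x → p.eval x = a * q.eval x := fun x hx => by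
    rwa [IsRoot.def, hfeval, sub_eq_zero] at hx
  have hfr : ∀ x, f.IsRoot x → r x = a := fun x hx => by
    simp only [hr]
    rw [div_eq_iff (hfq x hx), hfp x hx]
  have hfΨ : ∀ x, f.IsRoot x → E.Ψ₂Sq.eval x ≠ 0 := fun x hx h2 => haΨ x h2 (hfr x hx)
  -- `f` is separable: its roots are simple
  have hnodup : f.roots.Nodup := by
    rw [Multiset.nodup_iff_count_le_one]
    intro x
    rw [count_roots]
    by_contra hlt1
    push Not at hlt1
    obtain ⟨hx, hx'⟩ := (one_lt_rootMultiplicity_iff_isRoot hf0).mp hlt1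
    refine haD x ?_ (hfr x hx)
    have e1 := hfp x hx
    have e2 : (derivative p).eval x = a * (derivative q).eval x := by
      rwa [IsRoot.def, hf, derivative_sub, derivative_mul, derivative_C, zero_mul, zero_add,
        eval_sub, eval_mul, eval_C, sub_eq_zero] at hx'
    simp only [IsRoot.def, hD, eval_sub, eval_mul, e1, e2]
    ring
  set R : Finset L := f.roots.toFinset with hR
  have hRcard : R.card = n ^ 2 := by
    rw [hR, Multiset.toFinset_card_of_nodup hnodup, IsAlgClosed.card_roots_eq_natDegree, df]
  have hmemR : ∀ x, x ∈ R ↔ f.IsRoot x := fun x => by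
    rw [hR, Multiset.mem_toFinset, mem_roots hf0]
  -- the set `S` of affine points with abscissa in `R`
  set S : Set E.toAffine.Point := {P | ∃ x y, ∃ h : E.toAffine.Nonsingular x y,
    P = Affine.Point.some x y h ∧ x ∈ R} with hS
  have hScard : S.encard = 2 * (n ^ 2 : ℕ) := by
    rw [hS, E.encard_setOf_X_mem R fun x hx => hfΨ x ((hmemR x).mp hx), hRcard]
  -- the target point `Q₀ = (a, b)`
  have hab : E.toAffine.Nonsingular a (y₀ a) := hns a
  set Q₀ : E.toAffine.Point := .some a (y₀ a) hab with hQ₀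
  have hQneg : Q₀ ≠ -Q₀ := by
    rw [hQ₀, Affine.Point.neg_some]
    intro h
    simp only [Affine.Point.some.injEq, true_and] at h
    exact E.ne_negY_of_eval_Ψ₂Sq_ne_zero hab.1 ha2 h
  have hQ0 : ¬((0 : E.toAffine.Point) = Q₀ ∨ (0 : E.toAffine.Point) = -Q₀) := by
    rw [hQ₀, Affine.Point.neg_some]
    rintro (h | h)
    · exact Affine.Point.some_ne_zero _ h.symm
    · exact Affine.Point.some_ne_zero _ h.symm
  set A : Set E.toAffine.Point := {P | (n : ℤ) • P = Q₀} with hA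
  set B : Set E.toAffine.Point := {P | (n : ℤ) • P = -Q₀} with hB
  -- `S = A ∪ B`
  have hSAB : S = A ∪ B := by
    ext P
    simp only [hS, hA, hB, Set.mem_setOf_eq, Set.mem_union]
    cases P with
    | zero =>
      rw [← Affine.Point.zero_def, zsmul_zero]
      constructor
      · rintro ⟨x, y, h, h0, -⟩
        exact absurd h0.symm (Affine.Point.some_ne_zero h)
      · intro h
        exact absurd h hQ0
    | some x y h =>
      constructor
      · rintro ⟨x₁, y₁, h₁, e, hx₁⟩
        obtain ⟨rfl, rfl⟩ := (Affine.Point.some.injEq _ _ _ _ _ _).mp e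
        have hx : f.IsRoot x := (hmemR x).mp hx₁
        have hqx : q.eval x ≠ 0 := hfq x hx
        have hne : (n : ℤ) • Affine.Point.some x y h ≠ 0 := fun h0 =>
          hqx ((E.zsmul_some_eq_zero_iff_eval_ΨSq h n).mp h0)
        rcases hnP : (n : ℤ) • Affine.Point.some x y h with _ | ⟨x', y', h'⟩
        · exact absurd hnP hne
        · have hx' : x' * q.eval x = p.eval x := E.mul_eval_ΨSq_of_zsmul_eq h n h' hnP
          rw [hQ₀, ← Affine.Point.X_eq_iff]
          apply mul_right_cancel₀ hqx
          rw [hx', hfp x hx]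
      · intro hP
        refine ⟨x, y, h, rfl, (hmemR x).mpr ?_⟩
        by_cases hqx : q.eval x = 0
        · have h0 : (n : ℤ) • Affine.Point.some x y h = 0 :=
            (E.zsmul_some_eq_zero_iff_eval_ΨSq h n).mpr hqx
          rw [h0] at hP
          exact absurd hP hQ0
        · have hne : (n : ℤ) • Affine.Point.some x y h ≠ 0 := fun h0 =>
            hqx ((E.zsmul_some_eq_zero_iff_eval_ΨSq h n).mp h0)
          rcases hnP : (n : ℤ) • Affine.Point.some x y h with _ | ⟨x', y', h'⟩
          · exact absurd hnP hne
          · have hx' : x' * q.eval x = p.eval x := E.mul_eval_ΨSq_of_zsmul_eq h n h' hnP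
            rw [hnP, hQ₀, ← Affine.Point.X_eq_iff] at hP
            rw [IsRoot.def, hfeval, sub_eq_zero, ← hx', hP]
  -- `A` and `B` are disjoint and equinumerous
  have hdisj : Disjoint A B := by
    rw [Set.disjoint_left]
    intro P hPA hPB
    exact hQneg ((Eq.symm hPA).trans hPB)
  have eAB : A ≃ B := Equiv.subtypeEquiv (Equiv.neg _) fun P => by
    simp only [hA, hB, Set.mem_setOf_eq, Equiv.neg_apply, zsmul_neg, neg_inj]
  -- `A` is nonempty, hence a coset of `E[n]`
  have hAne : A.Nonempty := by
    have hRne : R.Nonempty := by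
      rw [← Finset.card_pos, hRcard]; positivity
    obtain ⟨x, hx⟩ := hRne
    have hPS : Affine.Point.some x (y₀ x) (hns x) ∈ S := ⟨x, _, hns x, rfl, hx⟩
    rw [hSAB] at hPS
    rcases hPS with hPA | hPB
    · exact ⟨_, hPA⟩
    · exact ⟨_, (eAB.symm ⟨_, hPB⟩).2⟩
  obtain ⟨P₀, hP₀⟩ := hAne
  have hP₀' : (n : ℤ) • P₀ = Q₀ := hP₀
  have eAT : A ≃ (AddSubgroup.torsionBy E.toAffine.Point (n : ℤ) : Set E.toAffine.Point) :=
    Equiv.subtypeEquiv (Equiv.subRight P₀) fun P => by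
      simp only [hA, Set.mem_setOf_eq, Equiv.subRight_apply, SetLike.mem_coe]
      rw [show P - P₀ ∈ AddSubgroup.torsionBy E.toAffine.Point (n : ℤ) ↔
          (n : ℤ) • (P - P₀) = 0 from Submodule.mem_torsionBy_iff (R := ℤ) _ _,
        zsmul_sub, hP₀', sub_eq_zero]
  -- cardinalities
  have hsum : A.encard + A.encard = ((2 * n ^ 2 : ℕ) : ℕ∞) := by
    have : S.encard = A.encard + B.encard := by rw [hSAB, Set.encard_union_eq hdisj]
    rw [Set.encard_congr eAB] at this ⊢
    rw [← this, hScard]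
    push_cast
    ring
  have hAfin : A.encard ≠ ⊤ := by
    intro h
    rw [h, top_add] at hsum
    exact ENat.top_ne_coe _ hsum
  obtain ⟨k, hk⟩ := ENat.ne_top_iff_exists.mp hAfin
  have hk2 : k = n ^ 2 := by
    rw [← hk, ← ENat.coe_add, ENat.coe_inj] at hsum
    omega
  rw [show Nat.card (AddSubgroup.torsionBy E.toAffine.Point (n : ℤ)) =
      Nat.card (AddSubgroup.torsionBy E.toAffine.Point (n : ℤ) : Set E.toAffine.Point) from rfl,
    Nat.card_coe_set_eq, Set.ncard_def, ← Set.encard_congr eAT, ← hk, hk2]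
  exact ENat.toNat_coe _

end Count

end WeierstrassCurve
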